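import Summits.BirchSwinnertonDyer.Rank1Residual.X2.LocalInertiaCohomologyMultiplicativeVanishing
import Summits.BirchSwinnertonDyer.Rank1Residual.X2.NonPrimitiveQuotientCorank
import Summits.BirchSwinnertonDyer.Rank1Residual.Iwasawa.InertiaCohomologyPTorsionFinite
import Literature.NumberTheory.EllipticCurves.TateUniformisation
import Literature.NumberTheory.Automorphic.AdicCompletionResidueCard
import Literature.NumberTheory.EllipticCurves.KellerYin2024.AnticyclotomicLocalEulerFactors
import HarnessLib

/-!
# The `f`-side per-place bound at a MULTIPLICATIVE place `w ∤ p` over a number field, split or not: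
# `zpCorank Y ≤ 𝟙[Nw ≡ ε_w (mod p)]`, `ε_w = χ_w(Frob_w) = ±1` the sign by which a Frobenius moves `√γ`

Cell `bsd-eis` (home `run/shared/lean/pub/bsd-eis/`), seat `bsd-line-x1-p1-w2` (D-0154 width seat on
crux 2 `GoodLatticeBDPValue` = stmt-BirchSwinnertonDyer-19032, line `halves` v14, stub
`stub_imprimCorank`, `f`-side conjunct `rem142_goodLattice_selmerAc_imprimitive`), file F3b-mult of the
unconditional `≤`-half.  The sequel of `SelmerAcSplitMultiplicativePlace` (p613424): there the UNTWISTED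
Tate parametrisation (`Silverman1994_thmV53_tateUniformisation`, needs the place to be split over `K`)
was used; here the TWISTED one (`Silverman1994_thmV53_corV54_tateUniformisation`, hypothesis `hT'`,
any multiplicative place, twist by the quadratic character `χ_w(σ) = σ(t)/t`, `t² = γ = −c₄/c₆`)
serves every multiplicative `w ∤ p` at once, with the two ARITHMETIC inputs on `γ` isolated as
hypotheses, to be supplied per curve:

* `hI` — `K_w(√γ)/K_w` is unramified: inertia fixes every square root `t` of `γ` in `K̄_w`
  (Silverman *ATAEC* V Ex. 5.11; over `ℚ` this is b2b X2 `GreenbergVatsalTateDatumRat.inertia_fix_sqrt_gamma`);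
* `hF` — the sign `ε = ±1` by which SOME Frobenius `φ` (`IsFrobPow φ 1`) moves `t` (`ε = 1` at a
  place split over `K_w`, `ε = −1` at a non-split one; over `ℚ`: X2 `GreenbergVatsalTateFrobeniusSign`).

Then (GV Prop. (2.4), inertia side, over `K`): every subgroup `Y` of the image of
`r_w : H¹(K_∞, E[p^∞]) → H¹(I_w(K_∞), E[p^∞])` has `zpCorank Y ≤ 1`
(`natCard_torsionBy_discreteH1_inertiaIn_le`: `#H¹(I_w, E[p^∞])[p] ≤ p`), and `= 0` unless
`Nw ≡ ε (mod p)` (`resH1Hom_inertiaIn_eq_zero_of_prime_nsmul_eq_zero_kerSubgroup`: the prime-to-`p` part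
of `φ` lies in `ker κ`, acts on `E[p^∞]/C` by `ε` and on the Kummer classes by `q_w = Nw`).  With
`P_w(X) = 1 − εX` this is exactly `rootMultiplicity((Nw)⁻¹, P̃_w) = 𝟙[Nw ≡ ε]`, the `curveLocalLambda`
recipe (`curveLocalLambda_of_localPolynomialAt_eq_one_sub_C_mul_X`).

* `zpCorank_le_one_of_hasMultiplicativeReductionAt` — `≤ 1` from `hI` alone;
* `zpCorank_le_of_hasMultiplicativeReductionAt_of_sign` — `≤ 𝟙[Nw ≡ ε]` from `hI`, `hF`;
* `zpCorank_le_of_frob_fixes_sqrt_gamma` / `zpCorank_le_of_frob_flips_sqrt_gamma` — `ε = 1` / `ε = −1`;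
* `curveLocalLambda_of_localPolynomialAt_eq_one_sub_C_mul_X` — bookkeeping for `P_w = 1 − εX`, `ε = ±1`;
  `curveLocalLambda_of_not_hasSplitMultiplicativeReductionAt` — the non-split case `P_w = 1 + X`.

HONEST FRAMING: tool theorems only (no definition, no named fact introduced — `hT'` is the tree's
existing twisted Tate-uniformisation fact taken as a hypothesis, D-0014), no `sorry`; closes nothing by
itself (`--supports stmt-BirchSwinnertonDyer-19032`); BSD / Mazur's main conjecture is proved for no curve.
The inputs `hI`, `hF` remain to be supplied for `E ×_ℚ K` at the Heegner places `w ∣ ℓ ‖ N_E`.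

References: Greenberg–Vatsal 2000 §2 Prop. (2.4) pp. 22–23, pp. 14–15; Silverman ATAEC V.5.2–5.4, Ex. 5.11;
Castella–Grossi–Lee–Skinner 2022 L893–901 (`𝒫_w(E)`); Keller–Yin §1.5 (L1337–1341).
-/

-- `Summit.BirchSwinnertonDyer.BirchSwinnertonDyer.…`: summit and sub-problem share a name (D-0017 layout).
set_option linter.dupNamespace false
set_option autoImplicit false

noncomputable section

open scoped Classical AddSubgroup

open CategoryTheory Function NumberField IsDedekindDomain Field ValuativeRel Polynomial
open Literature.NumberTheory.EllipticCurves Literature.NumberTheory.EllipticCurves.GreenbergSelmer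
  Literature.NumberTheory.GaloisRepresentations
  Literature.NumberTheory.GaloisRepresentations.IsNonarchimedeanLocalField
  Summit.BirchSwinnertonDyer.Rank1Residual Summit.BirchSwinnertonDyer.Rank1Residual.X2
  Summit.BirchSwinnertonDyer.Rank1Residual.X2.NonPrimitiveQuotientCorank

namespace Summit.BirchSwinnertonDyer.BirchSwinnertonDyer.Theorems.SelmerAcMultiplicativePlaceSign

variable {K : Type} [Field K] [NumberField K] {p : ℕ} [hp : Fact p.Prime]

/-- **`zpCorank Y ≤ 1` at a multiplicative `w ∤ p` with `K_w(√γ)/K_w` unramified**, for every subgroup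
`Y` of `H¹(I_w(K_∞), E[p^∞])`: `Y[p] ↪ H¹(I_w(K_∞), E[p^∞])[p]`, of order `≤ p`
(`natCard_torsionBy_discreteH1_inertiaIn_le` with the twisted Tate datum of `hT'`).
[cite: GreenbergVatsal2000, §2 Prop. (2.4) pp. 22–23]
[cite: SilvermanATAEC1994, Ch. V Lemma 5.2 (c), Thm. 5.3 (a),(b), Cor. 5.4 (held copy PDF pp. 406–410)] -/
theorem zpCorank_le_one_of_hasMultiplicativeReductionAt
    (hT' : Silverman1994_thmV53_corV54_tateUniformisation.{0}) (W : WeierstrassCurve K) [W.IsElliptic]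
    (κ : ZpExtension K p) {w : HeightOneSpectrum (𝓞 K)}
    (hpw : ((p : ℕ) : 𝓞 K) ∉ w.asIdeal) (hmult : W.HasMultiplicativeReductionAt w)
    (hI : ∀ t : AlgebraicClosure (w.adicCompletion K),
      t ^ 2 = algebraMap (w.adicCompletion K) (AlgebraicClosure (w.adicCompletion K))
        (algebraMap K (w.adicCompletion K) (-(W.c₄ / W.c₆))) →
      ∀ σ ∈ absInertia (w.adicCompletion K),
        Field.absoluteGaloisGroup.toAlgEquiv (w.adicCompletion K) σ t = t)
    (Y : AddSubgroup (discreteH1 (inertiaIn κ.kerSubgroup w) (W.geomPrimaryTorsion p))) :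
    zpCorank Y p ≤ 1 := by
  have hIH : inertia (K := K) w ≤ κ.kerSubgroup := Iwasawa.inertia_le_kerSubgroup' κ w hpw
  obtain ⟨q, t, Ψ, hq0, hq1, -, ht2, hsurj, hker, hΨσ, -⟩ := hT' W w hmult
  have hker' : ∀ u : (AlgebraicClosure (w.adicCompletion K))ˣ, Ψ (Additive.ofMul u) = 0 →
      ∃ a : ℤ, (u : AlgebraicClosure (w.adicCompletion K)) =
        algebraMap (w.adicCompletion K) (AlgebraicClosure (w.adicCompletion K)) q ^ a :=
    fun u h ↦ (hker u).1 h
  have ht := hI t ht2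
  obtain ⟨hfin, hcard⟩ :=
    LocalInertiaCohomologyMultiplicative.natCard_torsionBy_discreteH1_inertiaIn_le W p Ψ t hΨσ hsurj
      hq0 hq1 hker' ht hpw κ.kerSubgroup hmult hIH
  haveI := hfin
  let j : (↥Y)[(p : ℤ)] →
      (discreteH1 (inertiaIn κ.kerSubgroup w) (W.geomPrimaryTorsion p))[(p : ℤ)] :=
    fun y ↦ ⟨((y : Y) : _), by
      rw [AddSubgroup.torsionBy.nsmul_iff, ← AddSubmonoidClass.coe_nsmul,
        AddSubgroup.torsionBy.nsmul_iff.1 y.2, ZeroMemClass.coe_zero]⟩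
  have hj : Function.Injective j := fun a b hab ↦ by
    have h := congrArg Subtype.val hab
    exact Subtype.ext (Subtype.ext h)
  haveI : Finite ((↥Y)[(p : ℤ)]) := Finite.of_injective j hj
  exact zpCorank_le_one_of_natCard_torsionBy_le ((Nat.card_le_card_of_injective j hj).trans hcard)

/-- **At a MULTIPLICATIVE `w ∤ p`, split or not, every subgroup `Y` of the image of
`r_w : H¹(K_∞, E[p^∞]) → H¹(I_w(K_∞), E[p^∞])` has `zpCorank Y p ≤ 𝟙[Nw ≡ ε (mod p)]`**, `ε = ±1` the
sign by which some Frobenius `φ` of `K_w` moves a square root `t` of `γ = −c₄/c₆` (`p` odd, any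
`ℤ_p`-extension `κ` of the number field `K`, any elliptic `W/K` multiplicative at `w`, `K_w(√γ)/K_w`
unramified; granted the twisted Tate uniformisation `hT'`).  `≤ 1`:
`zpCorank_le_one_of_hasMultiplicativeReductionAt`; `= 0` when `p ∤ Nw − ε`: the image of `r_w` has no
`p`-torsion (prime-to-`p` part of `φ` lies in `ker κ`, acts on `E[p^∞]/C` by `ε` and on the Kummer
classes by `q_w = Nw`).  GV Prop. (2.4) (`corank 𝓗_ℓ = s_ℓ d_ℓ`, `d_ℓ = 𝟙[ℓ ≡ a_ℓ]`, `a_ℓ = ε`) per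
place of `K_∞`, over a number field.
[cite: GreenbergVatsal2000, §2 Prop. (2.4) pp. 22–23 and pp. 14–15]
[cite: SilvermanATAEC1994, Ch. V Lemma 5.2 (c), Thm. 5.3 (a),(b), Cor. 5.4 (held copy PDF pp. 406–410)] -/
theorem zpCorank_le_of_hasMultiplicativeReductionAt_of_sign
    (hT' : Silverman1994_thmV53_corV54_tateUniformisation.{0}) (W : WeierstrassCurve K) [W.IsElliptic]
    (hp2 : p ≠ 2) (κ : ZpExtension K p) {w : HeightOneSpectrum (𝓞 K)}
    (hpw : ((p : ℕ) : 𝓞 K) ∉ w.asIdeal) (hmult : W.HasMultiplicativeReductionAt w)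
    (hI : ∀ t : AlgebraicClosure (w.adicCompletion K),
      t ^ 2 = algebraMap (w.adicCompletion K) (AlgebraicClosure (w.adicCompletion K))
        (algebraMap K (w.adicCompletion K) (-(W.c₄ / W.c₆))) →
      ∀ σ ∈ absInertia (w.adicCompletion K),
        Field.absoluteGaloisGroup.toAlgEquiv (w.adicCompletion K) σ t = t)
    (ε : ℤ)
    (hF : ∀ t : AlgebraicClosure (w.adicCompletion K), t ≠ 0 →
      t ^ 2 = algebraMap (w.adicCompletion K) (AlgebraicClosure (w.adicCompletion K))
        (algebraMap K (w.adicCompletion K) (-(W.c₄ / W.c₆))) →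
      ∃ φ : absoluteGaloisGroup (w.adicCompletion K), IsFrobPow φ 1 ∧
        (if Field.absoluteGaloisGroup.toAlgEquiv (w.adicCompletion K) φ t = t then (1 : ℤ) else -1) = ε)
    (Y : AddSubgroup (discreteH1 (inertiaIn κ.kerSubgroup w) (W.geomPrimaryTorsion p)))
    (hY : ∀ y ∈ Y, ∃ c : subgroupH1 κ.kerSubgroup (W.geomPrimaryTorsion p),
      resH1Hom (inertiaInToH κ.kerSubgroup w) (AddMonoidHom.id (W.geomPrimaryTorsion p))
        (fun _ _ ↦ rfl) c = y) :
    zpCorank Y p ≤ if ((w.asIdeal.absNorm : ℤ) : ZMod p) = (ε : ZMod p) then 1 else 0 := by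
  split_ifs with hd
  · exact zpCorank_le_one_of_hasMultiplicativeReductionAt hT' W κ hpw hmult hI Y
  · -- `Nw ≢ ε (mod p)`: no `p`-torsion in the image of `r_w`
    have hIH : inertia (K := K) w ≤ κ.kerSubgroup := Iwasawa.inertia_le_kerSubgroup' κ w hpw
    have hq : (residueFieldCard (w.adicCompletion K) : ℤ) = (w.asIdeal.absNorm : ℤ) := by
      rw [Literature.NumberTheory.Automorphic.residueFieldCard_adicCompletion_eq]
      rfl
    obtain ⟨q, t, Ψ, hq0, hq1, ht0, ht2, hsurj, hker, hΨσ, -⟩ := hT' W w hmult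
    have hker' : ∀ u : (AlgebraicClosure (w.adicCompletion K))ˣ, Ψ (Additive.ofMul u) = 0 →
        ∃ a : ℤ, (u : AlgebraicClosure (w.adicCompletion K)) =
          algebraMap (w.adicCompletion K) (AlgebraicClosure (w.adicCompletion K)) q ^ a :=
      fun u h ↦ (hker u).1 h
    have ht := hI t ht2
    obtain ⟨φ, hφ, hε⟩ := hF t ht0 ht2
    have hcong : ¬ ((p : ℤ) ∣ (residueFieldCard (w.adicCompletion K) : ℤ) -
        (if Field.absoluteGaloisGroup.toAlgEquiv (w.adicCompletion K) φ t = t then 1 else -1)) := by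
      rw [hε, hq]
      intro hdvd
      exact hd ((ZMod.intCast_eq_intCast_iff_dvd_sub ε (w.asIdeal.absNorm : ℤ) p).mpr hdvd).symm
    refine le_of_eq (zpCorank_eq_zero_of_torsionBy_trivial fun y hpy ↦ ?_)
    obtain ⟨c, hc⟩ := hY _ y.2
    have hpc : p • resH1Hom (inertiaInToH κ.kerSubgroup w) (AddMonoidHom.id (W.geomPrimaryTorsion p))
        (fun _ _ ↦ rfl) c = 0 := by
      rw [hc, ← AddSubmonoidClass.coe_nsmul, hpy, ZeroMemClass.coe_zero]
    apply Subtype.ext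
    rw [ZeroMemClass.coe_zero, ← hc]
    exact LocalInertiaCohomologyMultiplicative.resH1Hom_inertiaIn_eq_zero_of_prime_nsmul_eq_zero_kerSubgroup
      W p Ψ t hΨσ hsurj hq0 hq1 hker' ht hpw κ hp2 hmult hIH ht2 hφ hcong c hpc

/-- **`ε = 1` (a Frobenius FIXES `√γ`, e.g. a place split over `K_w`): `zpCorank Y p ≤ 𝟙[Nw ≡ 1 (mod p)]`.**
[cite: GreenbergVatsal2000, §2 Prop. (2.4) pp. 22–23 and pp. 14–15] -/
theorem zpCorank_le_of_frob_fixes_sqrt_gamma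
    (hT' : Silverman1994_thmV53_corV54_tateUniformisation.{0}) (W : WeierstrassCurve K) [W.IsElliptic]
    (hp2 : p ≠ 2) (κ : ZpExtension K p) {w : HeightOneSpectrum (𝓞 K)}
    (hpw : ((p : ℕ) : 𝓞 K) ∉ w.asIdeal) (hmult : W.HasMultiplicativeReductionAt w)
    (hI : ∀ t : AlgebraicClosure (w.adicCompletion K),
      t ^ 2 = algebraMap (w.adicCompletion K) (AlgebraicClosure (w.adicCompletion K))
        (algebraMap K (w.adicCompletion K) (-(W.c₄ / W.c₆))) →
      ∀ σ ∈ absInertia (w.adicCompletion K),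
        Field.absoluteGaloisGroup.toAlgEquiv (w.adicCompletion K) σ t = t)
    (hF : ∀ t : AlgebraicClosure (w.adicCompletion K), t ≠ 0 →
      t ^ 2 = algebraMap (w.adicCompletion K) (AlgebraicClosure (w.adicCompletion K))
        (algebraMap K (w.adicCompletion K) (-(W.c₄ / W.c₆))) →
      ∃ φ : absoluteGaloisGroup (w.adicCompletion K), IsFrobPow φ 1 ∧
        Field.absoluteGaloisGroup.toAlgEquiv (w.adicCompletion K) φ t = t)
    (Y : AddSubgroup (discreteH1 (inertiaIn κ.kerSubgroup w) (W.geomPrimaryTorsion p)))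
    (hY : ∀ y ∈ Y, ∃ c : subgroupH1 κ.kerSubgroup (W.geomPrimaryTorsion p),
      resH1Hom (inertiaInToH κ.kerSubgroup w) (AddMonoidHom.id (W.geomPrimaryTorsion p))
        (fun _ _ ↦ rfl) c = y) :
    zpCorank Y p ≤ if (w.asIdeal.absNorm : ZMod p) = 1 then 1 else 0 := by
  have h := zpCorank_le_of_hasMultiplicativeReductionAt_of_sign hT' W hp2 κ hpw hmult hI 1
    (fun t ht0 ht2 ↦ by
      obtain ⟨φ, hφ, hfix⟩ := hF t ht0 ht2
      exact ⟨φ, hφ, by rw [if_pos hfix]⟩) Y hY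
  simpa only [Int.cast_natCast, Int.cast_one] using h

/-- **`ε = −1` (a Frobenius FLIPS `√γ`: a place NON-split over `K_w`): `zpCorank Y p ≤ 𝟙[Nw ≡ −1 (mod p)]`.**
[cite: GreenbergVatsal2000, §2 Prop. (2.4) pp. 22–23 and pp. 14–15] -/
theorem zpCorank_le_of_frob_flips_sqrt_gamma
    (hT' : Silverman1994_thmV53_corV54_tateUniformisation.{0}) (W : WeierstrassCurve K) [W.IsElliptic]
    (hp2 : p ≠ 2) (κ : ZpExtension K p) {w : HeightOneSpectrum (𝓞 K)}
    (hpw : ((p : ℕ) : 𝓞 K) ∉ w.asIdeal) (hmult : W.HasMultiplicativeReductionAt w)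
    (hI : ∀ t : AlgebraicClosure (w.adicCompletion K),
      t ^ 2 = algebraMap (w.adicCompletion K) (AlgebraicClosure (w.adicCompletion K))
        (algebraMap K (w.adicCompletion K) (-(W.c₄ / W.c₆))) →
      ∀ σ ∈ absInertia (w.adicCompletion K),
        Field.absoluteGaloisGroup.toAlgEquiv (w.adicCompletion K) σ t = t)
    (hF : ∀ t : AlgebraicClosure (w.adicCompletion K), t ≠ 0 →
      t ^ 2 = algebraMap (w.adicCompletion K) (AlgebraicClosure (w.adicCompletion K))
        (algebraMap K (w.adicCompletion K) (-(W.c₄ / W.c₆))) →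
      ∃ φ : absoluteGaloisGroup (w.adicCompletion K), IsFrobPow φ 1 ∧
        Field.absoluteGaloisGroup.toAlgEquiv (w.adicCompletion K) φ t ≠ t)
    (Y : AddSubgroup (discreteH1 (inertiaIn κ.kerSubgroup w) (W.geomPrimaryTorsion p)))
    (hY : ∀ y ∈ Y, ∃ c : subgroupH1 κ.kerSubgroup (W.geomPrimaryTorsion p),
      resH1Hom (inertiaInToH κ.kerSubgroup w) (AddMonoidHom.id (W.geomPrimaryTorsion p))
        (fun _ _ ↦ rfl) c = y) :
    zpCorank Y p ≤ if (w.asIdeal.absNorm : ZMod p) = -1 then 1 else 0 := by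
  have h := zpCorank_le_of_hasMultiplicativeReductionAt_of_sign hT' W hp2 κ hpw hmult hI (-1)
    (fun t ht0 ht2 ↦ by
      obtain ⟨φ, hφ, hflip⟩ := hF t ht0 ht2
      exact ⟨φ, hφ, by rw [if_neg hflip]⟩) Y hY
  simpa only [Int.cast_natCast, Int.cast_neg, Int.cast_one] using h

/-- **`λ(𝒫_w(f)) = [Γ : Γ_w] · 𝟙[Nw ≡ ε (mod p)]` when `P_w(X) = 1 − εX`, `ε = ±1`** (a multiplicative
place; `ε = 1` split, `ε = −1` non-split, Silverman C.16): the reduction of `P_w` is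
`−ε · (X − ε)` (`ε⁻¹ = ε`), with the simple root `X = ε`, so `rootMultiplicity((Nw)⁻¹, P̃_w) =
𝟙[(Nw)⁻¹ = ε] = 𝟙[Nw = ε]` in `𝔽_p` — the `f`-side local `λ`-value of KY §1.5 / CGLS L893–901 matches
the per-place bound `zpCorank_le_of_hasMultiplicativeReductionAt_of_sign` on the nose.
[cite: KellerYin2024, §1.5 (arXiv:2402.12781v2 TeX L1337–1341)] [cite: SilvermanAEC2009, §C.16 (PDF p. 390)] -/
theorem curveLocalLambda_of_localPolynomialAt_eq_one_sub_C_mul_X (κ : ZpExtension K p)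
    (W : WeierstrassCurve K) {w : HeightOneSpectrum (𝓞 K)} {ε : ℤ} (hε : ε = 1 ∨ ε = -1)
    (hP : W.localPolynomialAt w = 1 - C ε * X) :
    KellerYin2024.curveLocalLambda κ W w =
      KellerYin2024.numPlacesAbove κ w * (if ((w.asIdeal.absNorm : ℤ) : ZMod p) = (ε : ZMod p) then 1 else 0) := by
  rw [KellerYin2024.curveLocalLambda_eq]
  congr 1
  -- `P̃_w = C (-e) * (X - C e)` with `e = ε mod p`, `e * e = 1`
  have he2 : ((ε : ZMod p)) * (ε : ZMod p) = 1 := by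
    rcases hε with rfl | rfl <;> push_cast <;> ring
  have heinv : ((ε : ZMod p))⁻¹ = (ε : ZMod p) := inv_eq_of_mul_eq_one_left he2
  have hC : C (ε : ZMod p) * C (ε : ZMod p) = (1 : Polynomial (ZMod p)) := by
    rw [← map_mul, he2, map_one]
  have hfac : GreenbergVatsal2000.eulerFactorModP W p w = C (-(ε : ZMod p)) * (X - C (ε : ZMod p)) := by
    unfold GreenbergVatsal2000.eulerFactorModP
    rw [hP, Polynomial.map_sub, Polynomial.map_one, Polynomial.map_mul, Polynomial.map_C,
      Polynomial.map_X, eq_intCast]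
    calc (1 - C (ε : ZMod p) * X : Polynomial (ZMod p))
        = C (ε : ZMod p) * C (ε : ZMod p) - C (ε : ZMod p) * X := by rw [hC]
      _ = C (-(ε : ZMod p)) * (X - C (ε : ZMod p)) := by rw [map_neg]; ring
  have hne : (C (-(ε : ZMod p)) * (X - C (ε : ZMod p)) : Polynomial (ZMod p)) ≠ 0 := by
    refine mul_ne_zero ?_ (X_sub_C_ne_zero _)
    rw [Ne, map_eq_zero_iff _ C_injective, neg_eq_zero]
    intro h0
    rw [h0, mul_zero] at he2
    exact zero_ne_one he2
  rw [hfac, Polynomial.rootMultiplicity_mul hne, Polynomial.rootMultiplicity_C, zero_add,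
    Polynomial.rootMultiplicity_X_sub_C, Int.cast_natCast]
  by_cases h : (w.asIdeal.absNorm : ZMod p) = (ε : ZMod p)
  · rw [if_pos h, if_pos (by rw [h, heinv])]
  · rw [if_neg h, if_neg (fun h' ↦ h (by rw [← inv_inv (w.asIdeal.absNorm : ZMod p), h', heinv]))]

/-- **`λ(𝒫_w(f)) = [Γ : Γ_w] · 𝟙[Nw ≡ −1 (mod p)]` at a NON-split multiplicative place** (`P_w = 1 + X`,
`localPolynomialAt_of_hasMultiplicativeReductionAt_of_not_hasSplitMultiplicativeReductionAt`).
[cite: KellerYin2024, §1.5 (arXiv:2402.12781v2 TeX L1337–1341)] [cite: SilvermanAEC2009, §C.16 (PDF p. 390)] -/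
theorem curveLocalLambda_of_not_hasSplitMultiplicativeReductionAt (κ : ZpExtension K p)
    (W : WeierstrassCurve K) [W.IsElliptic] {w : HeightOneSpectrum (𝓞 K)}
    (hmult : W.HasMultiplicativeReductionAt w) (hns : ¬ W.HasSplitMultiplicativeReductionAt w) :
    KellerYin2024.curveLocalLambda κ W w =
      KellerYin2024.numPlacesAbove κ w * (if (w.asIdeal.absNorm : ZMod p) = -1 then 1 else 0) := by
  have hP : W.localPolynomialAt w = 1 - C (-1 : ℤ) * X := by
    rw [WeierstrassCurve.localPolynomialAt_of_hasMultiplicativeReductionAt_of_not_hasSplitMultiplicativeReductionAt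
      hmult hns, map_neg, map_one, neg_one_mul, sub_neg_eq_add]
  have h := curveLocalLambda_of_localPolynomialAt_eq_one_sub_C_mul_X (p := p) κ W (Or.inr rfl) hP
  simpa only [Int.cast_natCast, Int.cast_neg, Int.cast_one] using h

end Summit.BirchSwinnertonDyer.BirchSwinnertonDyer.Theorems.SelmerAcMultiplicativePlaceSign

end
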